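import Mathlib
import Summits.MatrixMultiplication.MatrixMultiplication.Theorems.SnSubsetDichotomyPolynomialSlackForcedCollision
import Summits.MatrixMultiplication.MatrixMultiplication.Theorems.SnSubsetDichotomyPolynomialSlackMarginals

/-!
# Two dense quotients: the kept identity and forced collisions

Crux `Summit.MatrixMultiplication.MatrixMultiplication.Theses.SnSubsetDichotomy.PolynomialSlack`
(item `stmt-MatrixMultiplication-8306`), level-one programme, lead c8 (two dense quotients: kept identity
and forced collisions).

For non-empty `S, T, U ⊆ S_n` (`n ≥ 2`, no triple product property needed) write
`m_{ST}(i,j) = #{(s,t) : t j = s i}`, `m_{TU}(j,k) = #{(t,u) : u k = t j}`, `m_{US}(k,i) = #{(u,s) : s i = u k}`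
for the pair marginals and `d_A = m_{ST}/|S||T|`, `d_B = m_{TU}/|T||U|`, `d_C = m_{US}/|U||S|` for the three
quotient profiles; `p_C = (d_C - 1/n)·[d_C ≥ θ_C]` is the heavy part of `d_C` at a level `θ_C ≥ 16/n`.
`twoDense_masses` records the bookkeeping of the two-dense-quotients case:

* the KEPT IDENTITY: since the row sums of `d_A` and the column sums of `d_B` are `1`
  (`sum_pairMarginal_snd`, `sum_pairMarginal_fst`),
  `Σ_j (d_A(i,j) - 1/n)(d_B(j,k) - 1/n) = Σ_j d_A(i,j) d_B(j,k) - 1/n`, so the kept level-one inequality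
  `1 - δ ≤ -(n-1)·Σ_{i,j,k} (d_A - 1/n)(d_B - 1/n) p_C` reads
  `1 - δ ≤ ((n-1)/n)·Σ_{k,i} p_C(k,i) - (n-1)·Σ_{k,i} p_C(k,i)·Σ_j d_A(i,j) d_B(j,k)`;
* FORCED COLLISIONS: `forced_collision` divided by `|S|·|T|²·|U|` is `d_C(k,i) ≤ n·Σ_j d_A(i,j) d_B(j,k)`,
  whence `Σ_{k,i} p_C d_C ≤ n·Σ_{k,i} p_C(k,i)·Σ_j d_A(i,j) d_B(j,k)`;
* the elementary facts `0 ≤ p_C ≤ d_C`, `p_C ≥ (15/16)·d_C` on heavy cells (`1/n ≤ θ_C/16`), nonnegativity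
  of the profiles and their unit row/column sums.
-/

namespace Summit.MatrixMultiplication.MatrixMultiplication.Theorems.PolynomialSlack

set_option linter.dupNamespace false

open scoped BigOperators

set_option maxHeartbeats 1600000 in
/-- **Two dense quotients: masses.** For `n ≥ 2`, non-empty `S, T, U ⊆ S_n` with quotient profiles
`dA, dB, dC`, a heavy threshold `θC ≥ 16/n` with heavy part `pC = (dC - 1/n)·[dC ≥ θC]`, and the kept
level-one inequality `1 - δ ≤ -(n-1)·Σ (dA - 1/n)(dB - 1/n) pC`:
(1) `1 - δ ≤ ((n-1)/n)·Σ pC - (n-1)·Σ_{k,i} pC(k,i)·Σ_j dA(i,j) dB(j,k)` (row sums of `dA` and column sums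
of `dB` are `1`); (2) `Σ pC·dC ≤ n·Σ_{k,i} pC(k,i)·Σ_j dA(i,j) dB(j,k)` (forced collisions);
(3)–(11) `0 ≤ pC ≤ dC`, `pC ≥ (15/16) dC` on heavy cells, `dA, dB, dC ≥ 0` with unit row sums of `dA`,
unit column sums of `dB` and unit row sums of `dC`. [folklore] -/
theorem twoDense_masses {n : ℕ} (hn : 2 ≤ n) {S T U : Finset (Equiv.Perm (Fin n))}
    (hS0 : S.Nonempty) (hT0 : T.Nonempty) (hU0 : U.Nonempty)
    (dA dB dC pC : Fin n → Fin n → ℝ)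
    (hdA : ∀ i j, dA i j = (((S ×ˢ T).filter fun st => st.2 j = st.1 i).card : ℝ) / (S.card * T.card : ℕ))
    (hdB : ∀ j k, dB j k = (((T ×ˢ U).filter fun tu => tu.2 k = tu.1 j).card : ℝ) / (T.card * U.card : ℕ))
    (hdC : ∀ k i, dC k i = (((U ×ˢ S).filter fun us => us.2 i = us.1 k).card : ℝ) / (U.card * S.card : ℕ))
    (θC δ : ℝ) (hθC : 16 / (n : ℝ) ≤ θC)
    (hpC : ∀ k i, pC k i = if θC ≤ dC k i then dC k i - 1 / n else 0)
    (hkept : 1 - δ ≤ -((n : ℝ) - 1) *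
      ∑ i : Fin n, ∑ j : Fin n, ∑ k : Fin n, (dA i j - 1 / n) * (dB j k - 1 / n) * pC k i) :
    (1 - δ ≤ ((n : ℝ) - 1) / n * (∑ k : Fin n, ∑ i : Fin n, pC k i) -
        ((n : ℝ) - 1) * ∑ k : Fin n, ∑ i : Fin n, pC k i * ∑ j : Fin n, dA i j * dB j k) ∧
    (∑ k : Fin n, ∑ i : Fin n, pC k i * dC k i ≤
        n * ∑ k : Fin n, ∑ i : Fin n, pC k i * ∑ j : Fin n, dA i j * dB j k) ∧
    (∀ k i, 0 ≤ pC k i) ∧ (∀ k i, pC k i ≤ dC k i) ∧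
    (∀ k i, θC ≤ dC k i → 15 / 16 * dC k i ≤ pC k i) ∧
    (∀ i j, 0 ≤ dA i j) ∧ (∀ j k, 0 ≤ dB j k) ∧ (∀ k i, 0 ≤ dC k i) ∧
    (∀ i, ∑ j : Fin n, dA i j = 1) ∧ (∀ k, ∑ j : Fin n, dB j k = 1) ∧
    (∀ k, ∑ i : Fin n, dC k i = 1) := by
  classical
  /- 0. scalars -/
  have hnR : (2 : ℝ) ≤ n := by exact_mod_cast hn
  have hn0 : (0 : ℝ) < n := by linarith
  have h16n : (0 : ℝ) < 16 / n := by positivity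
  have hθC0 : 0 < θC := lt_of_lt_of_le h16n hθC
  have h16 : (0 : ℝ) < 16 := by norm_num
  have hinvC : 1 / (n : ℝ) ≤ θC / 16 := by
    rw [div_le_div_iff₀ hn0 h16]; rw [div_le_iff₀ hn0] at hθC; linarith
  have h1n : (0 : ℝ) ≤ 1 / n := by positivity
  set cS : ℝ := (S.card : ℝ) with hcS
  set cT : ℝ := (T.card : ℝ) with hcT
  set cU : ℝ := (U.card : ℝ) with hcU
  have hcS0 : 0 < cS := by rw [hcS]; exact_mod_cast hS0.card_pos
  have hcT0 : 0 < cT := by rw [hcT]; exact_mod_cast hT0.card_pos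
  have hcU0 : 0 < cU := by rw [hcU]; exact_mod_cast hU0.card_pos
  have hαe : ((S.card * T.card : ℕ) : ℝ) = cS * cT := by push_cast; rw [hcS, hcT]
  have hβe : ((T.card * U.card : ℕ) : ℝ) = cT * cU := by push_cast; rw [hcT, hcU]
  have hγe : ((U.card * S.card : ℕ) : ℝ) = cU * cS := by push_cast; rw [hcU, hcS]
  /- 1. the marginals and the profiles -/
  set mA : Fin n → Fin n → ℝ := fun i j => (((S ×ˢ T).filter fun st => st.2 j = st.1 i).card : ℝ)
    with hmA
  set mB : Fin n → Fin n → ℝ := fun j k => (((T ×ˢ U).filter fun tu => tu.2 k = tu.1 j).card : ℝ)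
    with hmB
  set mC : Fin n → Fin n → ℝ := fun k i => (((U ×ˢ S).filter fun us => us.2 i = us.1 k).card : ℝ)
    with hmC
  have hdA' : ∀ i j, dA i j = mA i j / (cS * cT) := fun i j => by rw [hdA, hαe]
  have hdB' : ∀ j k, dB j k = mB j k / (cT * cU) := fun j k => by rw [hdB, hβe]
  have hdC' : ∀ k i, dC k i = mC k i / (cU * cS) := fun k i => by rw [hdC, hγe]
  have hmA0 : ∀ i j, 0 ≤ mA i j := fun i j => by simp only [hmA]; exact Nat.cast_nonneg _
  have hmB0 : ∀ j k, 0 ≤ mB j k := fun j k => by simp only [hmB]; exact Nat.cast_nonneg _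
  have hmC0 : ∀ k i, 0 ≤ mC k i := fun k i => by simp only [hmC]; exact Nat.cast_nonneg _
  -- the tree facts: row/column sums of the marginals and forced collisions
  have hsumA : ∀ i, ∑ j : Fin n, mA i j = cS * cT := fun i => by
    simp only [hmA, hcS, hcT]; exact_mod_cast sum_pairMarginal_snd S T i
  have hsumB : ∀ k, ∑ j : Fin n, mB j k = cT * cU := fun k => by
    simp only [hmB, hcT, hcU]; exact_mod_cast sum_pairMarginal_fst T U k
  have hsumC : ∀ k, ∑ i : Fin n, mC k i = cU * cS := fun k => by
    simp only [hmC, hcU, hcS]; exact_mod_cast sum_pairMarginal_snd U S k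
  have hfc : ∀ k i, cT ^ 2 * mC k i ≤ n * ∑ j : Fin n, mA i j * mB j k := fun k i => by
    simp only [hmA, hmB, hmC, hcT]; exact forced_collision S T U i k
  clear_value mA mB mC cS cT cU
  have hdA0 : ∀ i j, 0 ≤ dA i j := fun i j =>
    (hdA' i j).symm ▸ div_nonneg (hmA0 i j) (mul_pos hcS0 hcT0).le
  have hdB0 : ∀ j k, 0 ≤ dB j k := fun j k =>
    (hdB' j k).symm ▸ div_nonneg (hmB0 j k) (mul_pos hcT0 hcU0).le
  have hdC0 : ∀ k i, 0 ≤ dC k i := fun k i =>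
    (hdC' k i).symm ▸ div_nonneg (hmC0 k i) (mul_pos hcU0 hcS0).le
  -- row sums of `dA`, column sums of `dB` and row sums of `dC` are `1`
  have hrowA : ∀ i, ∑ j : Fin n, dA i j = 1 := by
    intro i
    simp_rw [hdA' i]
    rw [← Finset.sum_div, hsumA i, div_self (mul_pos hcS0 hcT0).ne']
  have hcolB : ∀ k, ∑ j : Fin n, dB j k = 1 := by
    intro k
    simp_rw [hdB' _ k]
    rw [← Finset.sum_div, hsumB k, div_self (mul_pos hcT0 hcU0).ne']
  have hrowC : ∀ k, ∑ i : Fin n, dC k i = 1 := by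
    intro k
    simp_rw [hdC' k]
    rw [← Finset.sum_div, hsumC k, div_self (mul_pos hcU0 hcS0).ne']
  -- forced collisions for the profiles: `dC k i ≤ n·Σ_j dA i j dB j k`
  have hforced : ∀ k i, dC k i ≤ n * ∑ j : Fin n, dA i j * dB j k := by
    intro k i
    rw [hdC' k i]
    simp_rw [hdA' i, hdB' _ k]
    have hexp : (n : ℝ) * ∑ j : Fin n, mA i j / (cS * cT) * (mB j k / (cT * cU)) =
        (n * ∑ j : Fin n, mA i j * mB j k) / (cS * cT * (cT * cU)) := by
      simp_rw [div_mul_div_comm, ← Finset.sum_div, mul_div_assoc]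
    rw [hexp, div_le_div_iff₀ (mul_pos hcU0 hcS0) (mul_pos (mul_pos hcS0 hcT0) (mul_pos hcT0 hcU0))]
    calc mC k i * (cS * cT * (cT * cU)) = cT ^ 2 * mC k i * (cU * cS) := by ring
      _ ≤ (n * ∑ j : Fin n, mA i j * mB j k) * (cU * cS) :=
          mul_le_mul_of_nonneg_right (hfc k i) (mul_pos hcU0 hcS0).le
  /- 2. the heavy part -/
  have hpC0 : ∀ k i, 0 ≤ pC k i := by
    intro k i; rw [hpC]; split_ifs with h <;> linarith [hinvC, hθC0]
  have hpCle : ∀ k i, pC k i ≤ dC k i := by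
    intro k i; rw [hpC]; split_ifs with h <;> linarith [hdC0 k i, h1n]
  have hpCheavy : ∀ k i, θC ≤ dC k i → 15 / 16 * dC k i ≤ pC k i := fun k i h => by
    rw [hpC, if_pos h]; linarith [hinvC]
  /- 3. the kept identity -/
  have hinner : ∀ k i, ∑ j : Fin n, (dA i j - 1 / n) * (dB j k - 1 / n) =
      ∑ j : Fin n, dA i j * dB j k - 1 / n := by
    intro k i
    have hexp : ∀ j, (dA i j - 1 / n) * (dB j k - 1 / n) =
        dA i j * dB j k - 1 / n * dA i j - 1 / n * dB j k + 1 / n * (1 / n) := fun j => by ring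
    simp_rw [hexp]
    rw [Finset.sum_add_distrib, Finset.sum_sub_distrib, Finset.sum_sub_distrib, ← Finset.mul_sum,
      ← Finset.mul_sum, hrowA i, hcolB k, Finset.sum_const, Finset.card_univ, Fintype.card_fin,
      nsmul_eq_mul]
    field_simp
    ring
  have htriple : ∑ i : Fin n, ∑ j : Fin n, ∑ k : Fin n, (dA i j - 1 / n) * (dB j k - 1 / n) * pC k i =
      ∑ k : Fin n, ∑ i : Fin n, pC k i * ∑ j : Fin n, dA i j * dB j k -
        1 / n * ∑ k : Fin n, ∑ i : Fin n, pC k i := by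
    calc ∑ i : Fin n, ∑ j : Fin n, ∑ k : Fin n, (dA i j - 1 / n) * (dB j k - 1 / n) * pC k i
        = ∑ i : Fin n, ∑ k : Fin n, ∑ j : Fin n, (dA i j - 1 / n) * (dB j k - 1 / n) * pC k i :=
          Finset.sum_congr rfl fun i _ => Finset.sum_comm
      _ = ∑ k : Fin n, ∑ i : Fin n, ∑ j : Fin n, (dA i j - 1 / n) * (dB j k - 1 / n) * pC k i :=
          Finset.sum_comm
      _ = ∑ k : Fin n, ∑ i : Fin n, pC k i * ∑ j : Fin n, (dA i j - 1 / n) * (dB j k - 1 / n) := by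
          refine Finset.sum_congr rfl fun k _ => Finset.sum_congr rfl fun i _ => ?_
          rw [Finset.mul_sum]
          exact Finset.sum_congr rfl fun j _ => by ring
      _ = ∑ k : Fin n, ∑ i : Fin n, pC k i * (∑ j : Fin n, dA i j * dB j k - 1 / n) := by
          simp_rw [hinner]
      _ = ∑ k : Fin n, ∑ i : Fin n, pC k i * ∑ j : Fin n, dA i j * dB j k -
            1 / n * ∑ k : Fin n, ∑ i : Fin n, pC k i := by
          rw [Finset.mul_sum, ← Finset.sum_sub_distrib]
          refine Finset.sum_congr rfl fun k _ => ?_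
          rw [Finset.mul_sum, ← Finset.sum_sub_distrib]
          exact Finset.sum_congr rfl fun i _ => by ring
  have hkeptId : 1 - δ ≤ ((n : ℝ) - 1) / n * (∑ k : Fin n, ∑ i : Fin n, pC k i) -
      ((n : ℝ) - 1) * ∑ k : Fin n, ∑ i : Fin n, pC k i * ∑ j : Fin n, dA i j * dB j k := by
    have hrew : -((n : ℝ) - 1) * (∑ k : Fin n, ∑ i : Fin n, pC k i * ∑ j : Fin n, dA i j * dB j k -
        1 / n * ∑ k : Fin n, ∑ i : Fin n, pC k i) =
        ((n : ℝ) - 1) / n * (∑ k : Fin n, ∑ i : Fin n, pC k i) -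
          ((n : ℝ) - 1) * ∑ k : Fin n, ∑ i : Fin n, pC k i * ∑ j : Fin n, dA i j * dB j k := by
      ring
    rw [htriple, hrew] at hkept
    exact hkept
  /- 4. forced collisions, weighted by the heavy part -/
  have hcoll : ∑ k : Fin n, ∑ i : Fin n, pC k i * dC k i ≤
      n * ∑ k : Fin n, ∑ i : Fin n, pC k i * ∑ j : Fin n, dA i j * dB j k := by
    rw [Finset.mul_sum]
    refine Finset.sum_le_sum fun k _ => ?_
    rw [Finset.mul_sum]
    refine Finset.sum_le_sum fun i _ => ?_
    calc pC k i * dC k i ≤ pC k i * (n * ∑ j : Fin n, dA i j * dB j k) :=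
          mul_le_mul_of_nonneg_left (hforced k i) (hpC0 k i)
      _ = n * (pC k i * ∑ j : Fin n, dA i j * dB j k) := by ring
  exact ⟨hkeptId, hcoll, hpC0, hpCle, hpCheavy, hdA0, hdB0, hdC0, hrowA, hcolB, hrowC⟩

end Summit.MatrixMultiplication.MatrixMultiplication.Theorems.PolynomialSlack
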